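import Summits.Ventures.Crystal3D.Theorems.StickyWulffConstantGenericWallFloorLayerRowsLedger
import Summits.Ventures.Crystal3D.Theorems.StickyWulffConstantGenericWallFloorStackNoReturn
import HarnessLib

/-!
# The LAYER ROWS LEDGER, repaired form: the h-row ends are separated from the c-ends by BOTTOM EXCLUSION + the APART input
# (crux `GenericWallFloor`, stmt-Ventures-19480, kernel G; LAYER ROWS step (iii-c)′ after `not_hRowEndFar` p724034; machine owner 19480-p2 g14)

HONEST FRAMING. Venture `Summits/Ventures/Crystal3D` (cell `crystal3d-full`), route `route-Ventures-StickyWulffConstant`, helper for the crux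
`GenericWallFloor` (stmt-Ventures-19480) / consumer `TextureLiminfV5` (stmt-Ventures-23912).  The count `layerRows_card_le_payers` of
`…LayerRowsLedger` (p721138) VERBATIM, except for the hypothesis separating family 3 (the h-row ends) from the two c-grains: the old `hfar₃`
(no rising certified state AT ALL at an h-end) is an instance of the refuted `HRowEndFar`; the repaired pair of hypotheses is
* `hbot₃` — no h-end carries a certified BOTTOM state `⟨A, u, 0⟩` or `⟨twinFrame A (A e₃), u, 0⟩` (discharged at an h-row end by
  `not_walkCertified_bottom_of_hFull`, (J-a)), and
* `hfar₃` — no h-end carries a rising strongly certified state whose frame lattice is APART from `A·Λ₀` and `(twinFrame A (A e₃))·Λ₀` (the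
  repaired named input `HRowEndFarApart κ`, (J-b′)).
They suffice because the TOP entry of a c-walker's sound well-formed stack is its bottom entry or APART (`top_bottom_or_apart`, …StackNoReturn;
for the second grain `twinFrame_twinFrame_axis` identifies the excluded pair).  Inputs BY NAME as in the whole lane (`ExactOnly` E1,
`DoubleStarCoaxialAt`, `CapPairCoaxial`); standard axioms; F-C1 not moved; NOT R1′ (the plate-side assembly follows).
* **`layerRows_card_le_payers_apart`**.
-/

noncomputable section

namespace Summit.Ventures.Crystal3D.Theorems

open Finset
open Literature.MathematicalPhysics.StatisticalMechanics (fccStacking barlowStacking IsHaggSeq basalMirror basalMirror_apply_coord)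
open scoped InnerProductSpace

variable {X : Finset (EuclideanSpace ℝ (Fin 3))}

open scoped Classical in
/-- **THE LAYER ROWS LEDGER, repaired form.**  See the module docstring.  `deg y = #(X.filter (dist y · = 1))`. -/
theorem layerRows_card_le_payers_apart (hX : ∀ p ∈ X, ∀ q ∈ X, p ≠ q → 1 ≤ dist p q)
    {s₀ : EuclideanSpace ℝ (Fin 3)} (hs₀ : s₀ ∈ fccSlots)
    (hcert : ExactOnly 0 (fccSlots.filter fun w => 0 < ⟪w, s₀⟫_ℝ))
    (hDS : ∀ F₁ F₂ : EuclideanSpace ℝ (Fin 3) ≃ₗᵢ[ℝ] EuclideanSpace ℝ (Fin 3), DoubleStarCoaxialAt F₁ F₂)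
    (hCP : CapPairCoaxial)
    {A : EuclideanSpace ℝ (Fin 3) ≃ₗᵢ[ℝ] EuclideanSpace ℝ (Fin 3)} {u : EuclideanSpace ℝ (Fin 3)} (hu : u ∈ fccSlots) (hu2 : u 2 = 0)
    {z : EuclideanSpace ℝ (Fin 3)} (hz : ‖z‖ = 1) {H : ℝ} (hH : ∀ q ∈ X, ⟪q, z⟫_ℝ ≤ H)
    {ι₁ ι₂ ι₃ : Type*} (T₁ : Finset ι₁) (T₂ : Finset ι₂) (T₃ : Finset ι₃)
    (st₁ : ι₁ → EuclideanSpace ℝ (Fin 3) × List WalkEntry) (st₂ : ι₂ → EuclideanSpace ℝ (Fin 3) × List WalkEntry)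
    (f₃ : ι₃ → EuclideanSpace ℝ (Fin 3)) (N : ℕ)
    (hst₁ : ∀ t ∈ T₁, WalkInv X z (st₁ t) ∧ StackWF z (st₁ t).2 ∧ (st₁ t).2.getLast? = some ⟨A, u, 0⟩ ∧
      (∃ e rest, (st₁ t).2 = e :: rest ∧ WalkCertified12 X (st₁ t).1 e) ∧ 8 * (H - ⟪(st₁ t).1, z⟫_ℝ) < 3 * N)
    (hst₂ : ∀ t ∈ T₂, WalkInv X z (st₂ t) ∧ StackWF z (st₂ t).2 ∧
      (st₂ t).2.getLast? = some ⟨twinFrame A (A (EuclideanSpace.single (2 : Fin 3) (1 : ℝ))), u, 0⟩ ∧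
      (∃ e rest, (st₂ t).2 = e :: rest ∧ WalkCertified12 X (st₂ t).1 e) ∧ 8 * (H - ⟪(st₂ t).1, z⟫_ℝ) < 3 * N)
    (hinj₁ : ∀ t ∈ T₁, ∀ t' ∈ T₁, walkRun X z N (st₁ t) = walkRun X z N (st₁ t') → t = t')
    (hinj₂ : ∀ t ∈ T₂, ∀ t' ∈ T₂, walkRun X z N (st₂ t) = walkRun X z N (st₂ t') → t = t')
    (hinj₃ : ∀ t ∈ T₃, ∀ t' ∈ T₃, f₃ t = f₃ t' → t = t')
    (hdeg₃ : ∀ t ∈ T₃, (X.filter fun q => dist (f₃ t) q = 1).card ≤ 11)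
    (hbot₃ : ∀ t ∈ T₃, ¬ WalkCertified12 X (f₃ t) ⟨A, u, 0⟩ ∧
      ¬ WalkCertified12 X (f₃ t) ⟨twinFrame A (A (EuclideanSpace.single (2 : Fin 3) (1 : ℝ))), u, 0⟩)
    (hfar₃ : ∀ t ∈ T₃, ∀ (F' : EuclideanSpace ℝ (Fin 3) ≃ₗᵢ[ℝ] EuclideanSpace ℝ (Fin 3)) (q : EuclideanSpace ℝ (Fin 3)),
      q ∈ fccSlots → (3 : ℝ) / 8 ≤ ⟪F' q, z⟫_ℝ →
      F' '' fccStacking 1 (Real.sqrt (2 / 3)) ≠ A '' fccStacking 1 (Real.sqrt (2 / 3)) →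
      F' '' fccStacking 1 (Real.sqrt (2 / 3)) ≠
        (twinFrame A (A (EuclideanSpace.single (2 : Fin 3) (1 : ℝ)))) '' fccStacking 1 (Real.sqrt (2 / 3)) →
      ¬ WalkCertified12 X (f₃ t) ⟨F', q, 0⟩)
    (PAY : Finset (EuclideanSpace ℝ (Fin 3)))
    (hPAY₁ : ∀ t ∈ T₁, (walkRun X z N (st₁ t)).1 ∈ PAY) (hPAY₂ : ∀ t ∈ T₂, (walkRun X z N (st₂ t)).1 ∈ PAY)
    (hPAY₃ : ∀ t ∈ T₃, f₃ t ∈ PAY) :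
    (T₁.card : ℝ) + T₂.card + T₃.card ≤ ∑ y ∈ PAY, ((12 : ℝ) - ((X.filter fun q => dist y q = 1).card : ℝ)) := by
  set e₃ : EuclideanSpace ℝ (Fin 3) := EuclideanSpace.single (2 : Fin 3) (1 : ℝ) with he₃
  set G := twinFrame A (A e₃) with hG
  set b₁ : WalkEntry := ⟨A, u, 0⟩ with hb₁
  set b₂ : WalkEntry := ⟨G, u, 0⟩ with hb₂
  have hbb : b₁ ≠ b₂ := twinBottom_ne A u
  set deg : EuclideanSpace ℝ (Fin 3) → ℕ := fun x => (X.filter fun q => dist x q = 1).card with hdeg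
  have hdeg12 : ∀ x, deg x ≤ 12 := fun x => card_filter_dist_eq_one_le_twelve X hX x
  set g₁ : ι₁ → EuclideanSpace ℝ (Fin 3) × List WalkEntry := fun t => walkRun X z N (st₁ t) with hg₁
  set g₂ : ι₂ → EuclideanSpace ℝ (Fin 3) × List WalkEntry := fun t => walkRun X z N (st₂ t) with hg₂
  -- the end data of the two c-grains
  have hend₁ : ∀ t ∈ T₁, deg (g₁ t).1 ≤ 11 ∧ WalkInv X z (g₁ t) ∧ StackWF z (g₁ t).2 ∧
      (g₁ t).2.getLast? = some b₁ ∧ (∃ e rest, (g₁ t).2 = e :: rest ∧ WalkCertified12 X (g₁ t).1 e) := by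
    intro t ht
    obtain ⟨hI, hW, hlast, hC, hN⟩ := hst₁ t ht
    obtain ⟨-, hydeg, -, -, -, -⟩ := stackWalk_end hX hs₀ hcert hz hH hI hN
    have hvalid := walkRun_valid hX hs₀ hcert hz N hI hW
    exact ⟨hydeg, hvalid.1, hvalid.2, by rw [hg₁]; simp only; rw [walkRun_getLast? hX hs₀ hcert hz N _ hI, hlast],
      walkRun_certified12 hX hs₀ hcert hz hI hC N⟩
  have hend₂ : ∀ t ∈ T₂, deg (g₂ t).1 ≤ 11 ∧ WalkInv X z (g₂ t) ∧ StackWF z (g₂ t).2 ∧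
      (g₂ t).2.getLast? = some b₂ ∧ (∃ e rest, (g₂ t).2 = e :: rest ∧ WalkCertified12 X (g₂ t).1 e) := by
    intro t ht
    obtain ⟨hI, hW, hlast, hC, hN⟩ := hst₂ t ht
    obtain ⟨-, hydeg, -, -, -, -⟩ := stackWalk_end hX hs₀ hcert hz hH hI hN
    have hvalid := walkRun_valid hX hs₀ hcert hz N hI hW
    exact ⟨hydeg, hvalid.1, hvalid.2, by rw [hg₂]; simp only; rw [walkRun_getLast? hX hs₀ hcert hz N _ hI, hlast],
      walkRun_certified12 hX hs₀ hcert hz hI hC N⟩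
  -- a c-end state at `y` carries a strongly certified entry rising by `≥ 3/8`, which is the BOTTOM entry or APART (no return)
  have hrise₁ : ∀ t ∈ T₁, ∃ e : WalkEntry,
      (e = b₁ ∨ (e.frame '' fccStacking 1 (Real.sqrt (2 / 3)) ≠ A '' fccStacking 1 (Real.sqrt (2 / 3)) ∧
        e.frame '' fccStacking 1 (Real.sqrt (2 / 3)) ≠ G '' fccStacking 1 (Real.sqrt (2 / 3)))) ∧
      e.dir ∈ fccSlots ∧ (3 : ℝ) / 8 ≤ ⟪e.frame e.dir, z⟫_ℝ ∧ WalkCertified12 X (g₁ t).1 ⟨e.frame, e.dir, 0⟩ := by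
    intro t ht
    obtain ⟨-, hI, hW, hlast, ⟨e, rest, hse, hC⟩⟩ := hend₁ t ht
    obtain ⟨-, hS, -⟩ := hI
    rw [hse] at hS hW hlast
    refine ⟨e, top_bottom_or_apart hu2 hS hW hlast, (show e.dir ∈ fccSlots from by
      cases rest with
      | nil => exact hS.1
      | cons e' r => exact hS.1.1), rise_top_of_stackSound hS, hC.eta⟩
  have hrise₂ : ∀ t ∈ T₂, ∃ e : WalkEntry,
      (e = b₂ ∨ (e.frame '' fccStacking 1 (Real.sqrt (2 / 3)) ≠ A '' fccStacking 1 (Real.sqrt (2 / 3)) ∧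
        e.frame '' fccStacking 1 (Real.sqrt (2 / 3)) ≠ G '' fccStacking 1 (Real.sqrt (2 / 3)))) ∧
      e.dir ∈ fccSlots ∧ (3 : ℝ) / 8 ≤ ⟪e.frame e.dir, z⟫_ℝ ∧ WalkCertified12 X (g₂ t).1 ⟨e.frame, e.dir, 0⟩ := by
    intro t ht
    obtain ⟨-, hI, hW, hlast, ⟨e, rest, hse, hC⟩⟩ := hend₂ t ht
    obtain ⟨-, hS, -⟩ := hI
    rw [hse] at hS hW hlast
    have hGG : twinFrame G (G e₃) = A := by rw [hG]; exact twinFrame_twinFrame_axis A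
    have hcase : e = b₂ ∨ (e.frame '' fccStacking 1 (Real.sqrt (2 / 3)) ≠ A '' fccStacking 1 (Real.sqrt (2 / 3)) ∧
        e.frame '' fccStacking 1 (Real.sqrt (2 / 3)) ≠ G '' fccStacking 1 (Real.sqrt (2 / 3))) := by
      rcases top_bottom_or_apart hu2 hS hW hlast with h | ⟨hA, hB⟩
      · exact Or.inl h
      · rw [hGG] at hB; exact Or.inr ⟨hB, hA⟩
    refine ⟨e, hcase, (show e.dir ∈ fccSlots from by
      cases rest with
      | nil => exact hS.1
      | cons e' r => exact hS.1.1), rise_top_of_stackSound hS, hC.eta⟩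
  -- THE COUNT per payer ball
  have hpt : ∀ y ∈ PAY, deg y + (T₁.filter fun t => (g₁ t).1 = y).card + (T₂.filter fun t => (g₂ t).1 = y).card +
      (T₃.filter fun t => f₃ t = y).card ≤ 12 := by
    intro y _
    set fib₁ := T₁.filter fun t => (g₁ t).1 = y with hfib₁
    set fib₂ := T₂.filter fun t => (g₂ t).1 = y with hfib₂
    set fib₃ := T₃.filter fun t => f₃ t = y with hfib₃
    -- family 3 has at most one member per ball
    have hfib₃ : fib₃.card ≤ 1 := by
      rw [Finset.card_le_one]
      intro a ha b hb
      obtain ⟨haT, hay⟩ := Finset.mem_filter.1 ha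
      obtain ⟨hbT, hby⟩ := Finset.mem_filter.1 hb
      exact hinj₃ a haT b hbT (hay.trans hby.symm)
    by_cases h3 : fib₃ = ∅
    · -- no h-row ends here: the two c-grains, cross pairs priced
      rw [h3, Finset.card_empty, add_zero]
      by_cases hemp : fib₁ = ∅ ∧ fib₂ = ∅
      · rw [hemp.1, hemp.2, Finset.card_empty, Finset.card_empty]; have := hdeg12 y; omega
      have hdegy : deg y ≤ 11 := by
        rw [not_and_or] at hemp
        rcases hemp with hne | hne
        · obtain ⟨t, ht⟩ := Finset.nonempty_iff_ne_empty.2 hne; obtain ⟨htT, hty⟩ := Finset.mem_filter.1 ht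
          have := (hend₁ t htT).1; rw [hty] at this; exact this
        · obtain ⟨t, ht⟩ := Finset.nonempty_iff_ne_empty.2 hne; obtain ⟨htT, hty⟩ := Finset.mem_filter.1 ht
          have := (hend₂ t htT).1; rw [hty] at this; exact this
      set ES₁ := fib₁.image g₁ with hES₁
      set ES₂ := fib₂.image g₂ with hES₂
      have hc₁ : ES₁.card = fib₁.card := Finset.card_image_of_injOn fun t ht t' ht' hft =>
        hinj₁ t (Finset.mem_filter.1 ht).1 t' (Finset.mem_filter.1 ht').1 hft
      have hc₂ : ES₂.card = fib₂.card := Finset.card_image_of_injOn fun t ht t' ht' hft =>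
        hinj₂ t (Finset.mem_filter.1 ht).1 t' (Finset.mem_filter.1 ht').1 hft
      have hES₁ok : ∀ s ∈ ES₁, s.1 = y ∧ WalkInv X z s ∧ StackWF z s.2 ∧ s.2.getLast? = some b₁ ∧
          (∃ e rest, s.2 = e :: rest ∧ WalkCertified12 X y e) := by
        intro s hs
        obtain ⟨t, ht, rfl⟩ := Finset.mem_image.1 hs; obtain ⟨htT, hty⟩ := Finset.mem_filter.1 ht
        obtain ⟨-, hI, hW, hlast, hC⟩ := hend₁ t htT; rw [hty] at hC
        exact ⟨hty, hI, hW, hlast, hC⟩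
      have hES₂ok : ∀ s ∈ ES₂, s.1 = y ∧ WalkInv X z s ∧ StackWF z s.2 ∧ s.2.getLast? = some b₂ ∧
          (∃ e rest, s.2 = e :: rest ∧ WalkCertified12 X y e) := by
        intro s hs
        obtain ⟨t, ht, rfl⟩ := Finset.mem_image.1 hs; obtain ⟨htT, hty⟩ := Finset.mem_filter.1 ht
        obtain ⟨-, hI, hW, hlast, hC⟩ := hend₂ t htT; rw [hty] at hC
        exact ⟨hty, hI, hW, hlast, hC⟩
      -- cross pairs: non-co-axial (a co-axial pair would be the two bottoms, both certified at `y`)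
      have hcross : ∀ s ∈ ES₁, ∀ s' ∈ ES₂, ∀ e rest e' rest', s.2 = e :: rest → s'.2 = e' :: rest' →
          (¬ ∃ (L : EuclideanSpace ℝ (Fin 3) ≃ₗᵢ[ℝ] EuclideanSpace ℝ (Fin 3))
              (s₁ s₂ : EuclideanSpace ℝ (Fin 3)) (σ σ' : ℤ → ℤ), IsHaggSeq σ ∧ IsHaggSeq σ' ∧
              e.frame '' fccStacking 1 (Real.sqrt (2 / 3)) ⊆ (fun p => L p + s₁) '' barlowStacking 1 (Real.sqrt (2 / 3)) σ ∧
              e'.frame '' fccStacking 1 (Real.sqrt (2 / 3)) ⊆ (fun p => L p + s₂) '' barlowStacking 1 (Real.sqrt (2 / 3)) σ') ∨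
          (starSet y e.frame e.dir ≠ starSet y e'.frame e'.dir ∧
            ∀ q ∈ X, dist y q = 1 → q ∈ starSet y e.frame e.dir ∪ starSet y e'.frame e'.dir) := by
        intro s hs s' hs' e rest e' rest' hse hse'
        left
        intro hco
        obtain ⟨hy, hI, hW, hlast, ⟨e₀, rest₀, hse₀, hC⟩⟩ := hES₁ok s hs
        obtain ⟨hy', hI', hW', hlast', ⟨e₀', rest₀', hse₀', hC'⟩⟩ := hES₂ok s' hs'
        have hS : StackSound z s.2 := hI.2.1
        have hS' : StackSound z s'.2 := hI'.2.1
        have he : e ∈ s.2 := by rw [hse]; exact List.mem_cons_self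
        have he' : e' ∈ s'.2 := by rw [hse']; exact List.mem_cons_self
        obtain ⟨heb, heb'⟩ := bottoms_of_coaxial_twinGrains hu2 hS hW hlast hS' hW' hlast' he he' hco
        -- the certified heads are the bottoms
        have h₀ : e₀ = e := by rw [hse] at hse₀; exact (List.cons.inj hse₀).1.symm
        have h₀' : e₀' = e' := by rw [hse'] at hse₀'; exact (List.cons.inj hse₀').1.symm
        rw [h₀, heb] at hC
        rw [h₀', heb'] at hC'
        exact not_both_certified12_twinBottoms hX hu hu2 hC hC'
      have key := card_contacts_add_endStates_le_twelve_cross hX hDS hCP hbb hdegy ES₁ ES₂ hES₁ok hES₂ok hcross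
      rw [hc₁, hc₂] at key
      exact key
    · -- an h-row ends here: no c-walker does
      obtain ⟨t₃, ht₃⟩ := Finset.nonempty_iff_ne_empty.2 h3
      obtain ⟨ht₃T, ht₃y⟩ := Finset.mem_filter.1 ht₃
      have hdegy : deg y ≤ 11 := by have := hdeg₃ t₃ ht₃T; rw [ht₃y] at this; exact this
      have h1 : fib₁ = ∅ := by
        rw [Finset.eq_empty_iff_forall_notMem]
        intro t ht
        obtain ⟨htT, hty⟩ := Finset.mem_filter.1 ht
        obtain ⟨e, hcase, hed, hrise, hC⟩ := hrise₁ t htT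
        rw [hty, ← ht₃y] at hC
        rcases hcase with rfl | ⟨hA, hB⟩
        · exact (hbot₃ t₃ ht₃T).1 hC
        · exact hfar₃ t₃ ht₃T e.frame e.dir hed hrise hA hB hC
      have h2 : fib₂ = ∅ := by
        rw [Finset.eq_empty_iff_forall_notMem]
        intro t ht
        obtain ⟨htT, hty⟩ := Finset.mem_filter.1 ht
        obtain ⟨e, hcase, hed, hrise, hC⟩ := hrise₂ t htT
        rw [hty, ← ht₃y] at hC
        rcases hcase with rfl | ⟨hA, hB⟩
        · exact (hbot₃ t₃ ht₃T).2 hC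
        · exact hfar₃ t₃ ht₃T e.frame e.dir hed hrise hA hB hC
      rw [h1, h2, Finset.card_empty, Finset.card_empty]
      omega
  -- summing over the payers
  have hsum₁ : T₁.card = ∑ y ∈ PAY, (T₁.filter fun t => (g₁ t).1 = y).card :=
    Finset.card_eq_sum_card_fiberwise fun t ht => hPAY₁ t ht
  have hsum₂ : T₂.card = ∑ y ∈ PAY, (T₂.filter fun t => (g₂ t).1 = y).card :=
    Finset.card_eq_sum_card_fiberwise fun t ht => hPAY₂ t ht
  have hsum₃ : T₃.card = ∑ y ∈ PAY, (T₃.filter fun t => f₃ t = y).card :=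
    Finset.card_eq_sum_card_fiberwise fun t ht => hPAY₃ t ht
  rw [hsum₁, hsum₂, hsum₃]; push_cast; rw [← Finset.sum_add_distrib, ← Finset.sum_add_distrib]
  refine Finset.sum_le_sum fun y hy => ?_
  have := hpt y hy
  have h' : (deg y : ℝ) + ((T₁.filter fun t => (g₁ t).1 = y).card : ℝ) + ((T₂.filter fun t => (g₂ t).1 = y).card : ℝ) +
      ((T₃.filter fun t => f₃ t = y).card : ℝ) ≤ 12 := by exact_mod_cast this
  simp only [hdeg] at h'; linarith

end Summit.Ventures.Crystal3D.Theorems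

end
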